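import Mathlib
import HarnessLib

/-!
# INV-6 cycle 2 (lens strengthen/negation away from the model point) — kernel face of the ADAPTIVE-`l` pricing
# (crux `ThetaPartII` = stmt-ABC-19678, route-ABC-IUTThetaPilot, registered skeleton RESHAPE-4, stub `stub_cor312PerImage` (iii-P))

Record-only sketch of the ideator seat abc-iut-inv-6 (cycle 2). TAKES NO SIDE on [IUTchIII] Cor. 3.12 or on any author (D-0045);
typed ≠ proved; nothing here is a route item, nothing asserts or refutes the stub; NO abc claim. Pure real/rational arithmetic.

(1) `excess_of_not_tameSixFloor` — the contrapositive currency of the landed necessity floor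
`Summit.ABC.IUTFork.PointDict.szpiro_of_cor312PerImageAtDatum_tame_six` (p437841): if the floor inequality FAILS at level `l ≥ 7`
with conductor term `C = log-diff + log-cond^{∤{2,l}} ≥ 0`, `q`-term `Q = log q^{∤{2,l}} ≥ 0`, `D = d_mod ≥ 0`, then the avoid-`{2,l}` Szpiro EXCESS
`Q − 6·C` exceeds `(6(4+8D)/l)·C + 30·log l + 276 + 12·log π` — i.e. a refuting datum at level `l` needs excess `≥ 72·C/l + 30 log l + 289` (`D = 1`):
first order in `1/l` on the conductor side, `O(log l)` additive. (Abstract reals; `logl`, `logpi` stand for `Real.log l`, `Real.log π`.)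
(2) The toy exact-content thresholds at `l = e = 7` (tame slot, unramified coefficient field, `v = v_p(q)` even, `r = v/2 mod 7`): with the landed
exact tame content `A = (ord t − 1) div e + 1 − (j+1)` (`Literature.IUT.LogVolume.TameContent.*`, seat abc-iut-c312-1 R22) the per-label credit is
`j(1 − 1/e) + φ_j`, `φ_j = fract((j²·r − 1)/7)`; `Φ_QR = Σ_{j=1}^{3} φ_j = 4/7` for `r = 1` and `Φ_QNR = 11/7` for `r = 3`, giving per-prime ratio
thresholds `6(1 − 1/7) + Φ = 40/7 < 6 < 47/7` (debit coefficient `(l²−1)/48 = 1` at `l = 7`). Illustration only of «the exact per-prime threshold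
`v*_p = 6(1 − 1/e_p) + 48·Φ_p/(l²−1) ∈ [6(1 − 1/e_p), 6(1 − 1/e_p) + 24/(l+1))` straddles 6 by residue class»; for a genuine datum `e_p = c_p·l` with
`30/gcd(30, v_p) ∣ c_p` (`E[30] ⊆ E(F)`; the weights `1 − 1/(l·lcm(30/gcd(30,e_p), c_p))` of `cor312PerImageOf_ratPoint_sharp_closedForm`), so the toy
`e = l` is the sub-case `30 ∣ v_p`; nothing about a genuine datum is computed here.
[cite: Mochizuki2012, IUTchIV Thm. 1.10 proof Steps (ii)–(x) p. 24–32] [claim: Mochizuki2012, status: disputed] [folklore] arithmetic.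
-/

set_option linter.dupNamespace false

namespace Summit.ABC.ABC.Cruxes.ThetaPartII.InvSixCycleTwo

/-- (1) Excess currency of a failed tame-six floor: `Q − 6C > (6(4+8D)/l)·C + 30·logl + 276 + 12·logpi`. [folklore] -/
theorem excess_of_not_tameSixFloor (l C Q D logl logpi : ℝ) (hl : 7 ≤ l) (hQ : 0 ≤ Q)
    (h : ¬ ((1 / 6 - 2 / (l * (l + 1))) * Q ≤ (1 + (4 + 8 * D) / l) * C + 5 * logl + 46 + 2 * logpi)) :
    (6 * (4 + 8 * D) / l) * C + 30 * logl + 276 + 12 * logpi < Q - 6 * C := by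
  push Not at h
  have hl0 : 0 < l := by linarith
  have hden : 0 < l * (l + 1) := by positivity
  have hdrop : (1 / 6 - 2 / (l * (l + 1))) * Q ≤ (1 / 6) * Q := by
    have : 0 ≤ 2 / (l * (l + 1)) * Q := by positivity
    nlinarith
  have h6 : (1 + (4 + 8 * D) / l) * C + 5 * logl + 46 + 2 * logpi < Q / 6 := by linarith
  have e : (6 * (4 + 8 * D) / l) * C = 6 * ((4 + 8 * D) / l * C) := by ring
  rw [e]
  nlinarith

/-- (1') With `D = d_mod = 1`: the refutation ticket at level `l` is an excess `> 72·C/l + 30·logl + 276 + 12·logpi`. [folklore] -/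
theorem excess_of_not_tameSixFloor_dmod_one (l C Q logl logpi : ℝ) (hl : 7 ≤ l) (hQ : 0 ≤ Q)
    (h : ¬ ((1 / 6 - 2 / (l * (l + 1))) * Q ≤ (1 + (4 + 8 * 1) / l) * C + 5 * logl + 46 + 2 * logpi)) :
    72 / l * C + 30 * logl + 276 + 12 * logpi < Q - 6 * C := by
  have := excess_of_not_tameSixFloor l C Q 1 logl logpi hl hQ h
  have e : (6 * (4 + 8 * (1:ℝ)) / l) * C = 72 / l * C := by ring
  linarith [e ▸ this]

/-- (1'') The adaptive choice `l ≥ C` (level of the size of the conductor logarithm) turns the ticket into a POLYLOG-loss `ε`-free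
Szpiro shape: excess `> 30·logl + 348 + 12·logpi` suffices for nothing less — here only the trivial direction `72/l·C ≤ 72`. [folklore] -/
theorem ticket_of_level_ge_cond (l C : ℝ) (hl : 0 < l) (_hC : 0 ≤ C) (hlC : C ≤ l) : 72 / l * C ≤ 72 := by
  rw [div_mul_eq_mul_div, div_le_iff₀ hl]
  nlinarith

/-! ## (2) Toy exact-content thresholds at `l = e = 7` -/

/-- `⌊3/7⌋ = 0`, `⌊8/7⌋ = 1`, `⌊2/7⌋ = 0`, `⌊11/7⌋ = 1`, `⌊26/7⌋ = 3` over `ℚ`. [folklore] -/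
theorem floor_facts :
    ⌊(3 : ℚ) / 7⌋ = 0 ∧ ⌊(8 : ℚ) / 7⌋ = 1 ∧ ⌊(2 : ℚ) / 7⌋ = 0 ∧ ⌊(11 : ℚ) / 7⌋ = 1 ∧ ⌊(26 : ℚ) / 7⌋ = 3 ∧ ⌊(0 : ℚ) / 7⌋ = 0 := by
  refine ⟨?_, ?_, ?_, ?_, ?_, ?_⟩ <;> (rw [Int.floor_eq_iff]; norm_num)

/-- `Φ_QR(7) = fract(0/7) + fract(3/7) + fract(8/7) = 4/7` (labels `j = 1,2,3`, residue `r = 1`: `(j²r − 1)/7 = 0/7, 3/7, 8/7`). [folklore] -/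
theorem Phi_QR_seven : Int.fract ((0 : ℚ) / 7) + Int.fract ((3 : ℚ) / 7) + Int.fract ((8 : ℚ) / 7) = 4 / 7 := by
  obtain ⟨h3, h8, -, -, -, h0⟩ := floor_facts
  simp only [Int.fract, h3, h8, h0]
  norm_num

/-- `Φ_QNR(7) = fract(2/7) + fract(11/7) + fract(26/7) = 11/7` (residue `r = 3`: `(j²r − 1)/7 = 2/7, 11/7, 26/7`). [folklore] -/
theorem Phi_QNR_seven : Int.fract ((2 : ℚ) / 7) + Int.fract ((11 : ℚ) / 7) + Int.fract ((26 : ℚ) / 7) = 11 / 7 := by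
  obtain ⟨-, -, h2, h11, h26, -⟩ := floor_facts
  simp only [Int.fract, h2, h11, h26]
  norm_num

/-- Debit coefficient `(l²−1)/48 = 1` and passive credit `Σ_{j=1}^{3} j·(1 − 1/7) = 36/7` at `l = 7`; thresholds `36/7 + 4/7 = 40/7 < 6 < 47/7 = 36/7 + 11/7`.
[folklore] -/
theorem toy_thresholds_seven :
    ((7 : ℚ) ^ 2 - 1) / 48 = 1 ∧ (1 + 2 + 3) * (1 - 1 / (7 : ℚ)) = 36 / 7 ∧
      (36 : ℚ) / 7 + 4 / 7 = 40 / 7 ∧ (36 : ℚ) / 7 + 11 / 7 = 47 / 7 ∧ (40 : ℚ) / 7 < 6 ∧ (6 : ℚ) < 47 / 7 := by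
  norm_num

/-- The straddle in words: at `l = e = 7` the exact per-prime threshold is `< 6` on the residue class of `Φ = 4/7` and `> 6` on that of `Φ = 11/7`;
in general it lies in `[6(1 − 1/e), 6(1 − 1/e) + 48·l⋆/(l²−1))` — here `[36/7, 36/7 + 3)`. [folklore] -/
theorem window_seven : (6 : ℚ) * (1 - 1 / 7) = 36 / 7 ∧ (48 : ℚ) * 3 / (7 ^ 2 - 1) = 3 := by norm_num

/-! ## (3) The fractional credit is a quadratic-residue sum (EXACT shape, toy checks)

For a tame slot with `CondP2` (`l ∤ v_p`), `v_p` even, `e_p = c_p·l`: `φ_j = (c_p·(s'·j² mod l) − 1)/(c_p·l)` with `s' = v_p/2`, and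
`j ↦ s'·j² mod l` (`j = 1 … l⋆`) enumerates the nonzero quadratic residues (resp. non-residues) mod `l` once each, so
`Φ_p = l⋆/2 − l⋆/(c_p·l) ∓ [l ≡ 3 (4)]·h(−l)/2` (Dirichlet: `Σ QNR − Σ QR = l·h(−l)` for `l ≡ 3 (4)`, `l > 3`; `= 0` for `l ≡ 1 (4)`),
whence `v*_p = 6 + 12/(l+1) − 6(l+5)/(c_p·l·(l+1)) ∓ 24·h(−l)/(l²−1)`: to leading order `6 + 12/l`, INDEPENDENT of `p` and `v_p`.
Toy checks below: `l = 7` (`h(−7) = 1`): `3/2 − 3/7 ∓ 1/2 = 4/7, 11/7` (matches (2)); `l = 11` (`h(−11) = 1`): QR = {1,3,4,5,9} (sum 22),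
QNR = {2,6,7,8,10} (sum 33), `Φ_QR = (22 − 5)/11 = 17/11 = 5/2 − 5/11 − 1/2`. [folklore] -/

/-- The nonzero squares mod 11 are exactly `{1, 3, 4, 5, 9}`. [folklore] -/
theorem squares_mod_eleven :
    ∀ x : ZMod 11, x ≠ 0 → ((∃ y : ZMod 11, y * y = x) ↔ x ∈ ({1, 3, 4, 5, 9} : Finset (ZMod 11))) := by
  decide

/-- The nonzero squares mod 7 are exactly `{1, 2, 4}`. [folklore] -/
theorem squares_mod_seven :
    ∀ x : ZMod 7, x ≠ 0 → ((∃ y : ZMod 7, y * y = x) ↔ x ∈ ({1, 2, 4} : Finset (ZMod 7))) := by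
  decide

/-- Residue sums and the class-number shape of `Φ` at `l = 7, 11` (`c_p = 1`): `Σ QR(7) = 7`, `Σ QNR(7) = 14` (difference `7·h(−7)`),
`Σ QR(11) = 22`, `Σ QNR(11) = 33` (difference `11·h(−11)`); `Φ_QR(7) = (7 − 3)/7 = 4/7 = 3/2 − 3/7 − 1/2`, `Φ_QNR(7) = (14 − 3)/7 = 11/7 = 3/2 − 3/7 + 1/2`,
`Φ_QR(11) = (22 − 5)/11 = 17/11 = 5/2 − 5/11 − 1/2`, and the threshold shape `6 + 12/(l+1) − 6(l+5)/(l(l+1)) ∓ 24/(l²−1)` at `l = 7` is `40/7, 47/7`. [folklore] -/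
theorem Phi_classNumber_shape :
    (1 + 2 + 4 : ℚ) = 7 ∧ (3 + 5 + 6 : ℚ) = 14 ∧ (1 + 3 + 4 + 5 + 9 : ℚ) = 22 ∧ (2 + 6 + 7 + 8 + 10 : ℚ) = 33 ∧
    ((7 : ℚ) - 3) / 7 = 3 / 2 - 3 / 7 - 1 / 2 ∧ ((14 : ℚ) - 3) / 7 = 3 / 2 - 3 / 7 + 1 / 2 ∧
    ((22 : ℚ) - 5) / 11 = 5 / 2 - 5 / 11 - 1 / 2 ∧
    (6 : ℚ) + 12 / (7 + 1) - 6 * (7 + 5) / (7 * (7 + 1)) - 24 / (7 ^ 2 - 1) = 40 / 7 ∧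
    (6 : ℚ) + 12 / (7 + 1) - 6 * (7 + 5) / (7 * (7 + 1)) + 24 / (7 ^ 2 - 1) = 47 / 7 := by
  norm_num

end Summit.ABC.ABC.Cruxes.ThetaPartII.InvSixCycleTwo
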